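import Literature.MathematicalPhysics.QuantumFieldTheory.King1986.SlicePropagatorStatementsAt
import Summits.QuantumFields.YangMills.Theorems.BalabanUVNodesN15KingModelProp37AtRegularFieldHolder

/-!
# N15 (NE2⁺, row s3 KING-MODEL ∕ RIEMANN-KERNEL RUNG) — PART Ζ-b: KING 1986 PROPOSITION 3.7 **BY NAME AT A REGULAR BACKGROUND `A ≠ 0`**
# (`King1986.SlicePropagator.Prop37PrintedAt`, `Prop37KingOrder`) for the slices of [Ba1] (2.43) = King (2.17) AT THE LIVE FIELD on `Ω = T_ε`

count-neutral helper of the pub-ymgap K3⁸ programme (`--supports stmt-QuantumFields-27366`); nothing here is a claim about Bałaban's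
non-abelian `G(U)`, the continuum, ℝ⁴, OS axioms, a mass gap or the Clay problem.  One finite torus `T_ε` at fixed `ε`.

## What is printed

[King1986] = C. King, *The U(1) Higgs model. I. The continuum limit*, Commun. Math. Phys. **102** (1986) 649–677, Prop. 3.7 (3.63)–(3.65) p. 663
[PDF 15] (quoted in PART Ζ-a) and p. 663 l. 33: *"Proposition 3.7 follows immediately from Theorem 3.3 and the scaling properties of the
operators."*; p. 665 [PDF 17] l. 22–23: *"We note that Proposition 3.7 also holds for G^η_{(j)}(Ω′) and G^η_{(j)}(Ω′, A^{(k)}), since Theorem 3.3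
gives bounds on these operators also."*; the slices are those of (2.17) p. 654, *"G^η_k = Σ_{j=0}^{k−1} G^η_{(j)}"*, i.e. [Balaban1982Higgs1] (2.43)
p. 612 (`G^ε_k = Σ_{j=1}^{k−1}a_j²(L^jε)^{−4}G_jQ_j^*C^{(j)}Q_jG_j + C^{(0)}`) — PROVED in the tree for Bałaban's covariant operators at EVERY field `A`
(lit-balaban p35 `B1Eq243HiggsModel.display243_univ`; the pieces as operators: p26 `B3Ineq210RegularTorus.pieceA`, `sum_pieceA`).
[Balaban1983Higgs3] (2.10)–(2.11) p. 426 = (3.63) and the transported (3.65)₂ for these pieces at a regular background, PROVED on `T_η` by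
p26 (`ineq210_regularTorus`, `ineq211At_regularTorus`, `ineq210_and_211At_regularTorusH`).

## What this file proves

* §1 `kingSliceKernelsReg S C A m² a k : SliceKernels P.d` — KING's DATUM at the regular background `A` on `T_ε`, level `k` (`η = L^{−k}`): p26's
  carrier `regTorusKernels` RESCALED to King's units — `dist x y = L^{−k}|x − y|` (lattice steps `|x − y|` = [Ba1] (1.3)), `G j x y =
  (L^kε)^{d−2}·|G^η_{(j)}(x, y)|`, `dG j μ x y = (L^kε)^{d−1}·|(D_{A,μ}G^η_{(j)})(x, y)|` (the `η^d`-kernels of the rescaled operators (2.22):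
  `G_k = (L^kε)^{−2}G^ε_k`, `∂^η = (L^kε)·D^ε`), `B = PEmpty` ((3.64) is the vector-field slice clause — empty by type here, exactly as g17's `A = 0`
  datum `kingSliceKernels`); unit lemmas `slice_kingSliceKernelsReg` (`L^jη = L^jε/(L^kε)`), `dist_…`, the three scaling identities.
* §2 ★★★ **`prop37PrintedAt_king_regularField`** — PROPOSITION 3.7 AT ONE HÖLDER EXPONENT, KING's ORDER «0 < α < 1, and …», AT A REGULAR `A`:
  `∃ K₀min, ∀ α ∈ (0,1), ∃ t C δ₀ > 0 (per cube size K₀), ∀ K₀ ≥ K₀min, ∀ cubic torus of r14's sub-family (Shape P, P.d = d, P.L = L, K₀ ∣ M, 3K₀ ≤ 2M),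
  ∀ 1 ≤ k ≤ K_P with L^kε ≤ 1, ∀ A with |ΔA| ≤ δ_A, L^k·δ_A·|e| ≤ t(K₀): Prop37PrintedAt α (kingSliceKernelsReg S C A m² a k) (C K₀) (δ₀ K₀)` —
  (3.63) = p26's (2.10); (3.65)₁ = PART Ζ-a `absG_holder_le`; (3.65)₂ = PART Ζ-a `absDG_holder_le` ((2.11) + isometry); (3.64) vacuous.
* §3 ★★★ **`prop37KingOrder_king_flatField`** — `Prop37KingOrder (kingSliceKernelsReg S C A m² a k)` for EVERY LATTICE-CONSTANT background
  `A` (`ΔA = 0`: the flat connections of the torus — arbitrary constant holonomies, `A ≠ 0`), every `K₀ ≥ K₀min`, cubic torus, `1 ≤ k ≤ K_P`,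
  `L^kε ≤ 1` (the print-order schema needs the hypotheses for every `α` at once; a regular `A` with `ΔA ≠ 0` meets King's `α`-dependent
  threshold `t(α)` only `α` by `α` — §2 is its faithful form); `prop37KingOrder_king_zeroField_reg` (the member `A = 0`).

HONEST SCOPE.  `|G|`, `|∂G|` and the Hölder quotient (3.62) are READ on the gauge-invariant block norm (column-sum norm of the `N × N` block,
p26's reading; transports immaterial — PART Ζ-a); `Ω = T_ε` (King's `Ω′`-version = p26's box files, not instantiated here); `m² > 0`; cubic
tori of the `Shape` sub-family tiled by `K₀`-cubes; constants existential, per `(α, K₀)`; (3.64) empty by type; the sum rule (2.17) for the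
pieces is p26's `sum_pieceA` (operators), not a field of the datum.  NOT an η-rate (King's Props 3.8∕3.9 are `A = 0` statements, p. 670);
NE2⁺ for Bałaban's `G(U)` NOT proved; N15 NOT discharged.  Unit `pub-ymgap-dag-n15-e` g22 (R141 (C) s3), PART Ζ-b.
-/

noncomputable section

open scoped BigOperators

namespace Summit.QuantumFields.YangMills.BalabanUVNodes.N15KingModelRung.RegularField

open Literature.MathematicalPhysics.QuantumFieldTheory.Balaban1983to89
open Literature.MathematicalPhysics.QuantumFieldTheory.Balaban1983to89.HiggsLattice (ChargeData ScalarField covDeriv)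
open Literature.MathematicalPhysics.QuantumFieldTheory.Balaban1983to89.B1Ineq234LevelZero (tdist_comm)
open Literature.MathematicalPhysics.QuantumFieldTheory.Balaban1983to89.B1Ineq234Concrete (tdist_self)
open Literature.MathematicalPhysics.QuantumFieldTheory.Balaban1983to89.B3Sect2StatementsPart2 (ScaledKernels)
open Literature.MathematicalPhysics.QuantumFieldTheory.Balaban1983to89.B1Eq211ZeroFieldTorus (Shape)
open Literature.MathematicalPhysics.QuantumFieldTheory.Balaban1983to89.B3Ineq210RegularTorus (regTorusKernels regTorusKernels_absG
  regTorusKernels_absDG regTorusKernels_dist scale_eq mesh_eq_pow_mul)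
open Literature.MathematicalPhysics.QuantumFieldTheory.Balaban1983to89.B3Ineq211RegularTorus (one_le_tdist_of_ne' regTorusKernelsH
  ineq210_iff_H ineq210_and_211At_regularTorusH)
open Literature.MathematicalPhysics.QuantumFieldTheory.King1986.SlicePropagator (SliceKernels holderDeriv Prop37PrintedAt Prop37KingOrder)
open Literature.MathematicalPhysics.QuantumFieldTheory.King1986 (ContinuumLimit.eps)

variable {P : HiggsLattice.Params} {N : ℕ}

/-! ## §1 King's datum at a regular background: p26's carrier in `η = L^{−k}` units -/

/-- ★ **KING's PROP-3.7 DATUM AT THE REGULAR BACKGROUND `A` ON `T_ε`, LEVEL `k`** (`η = L^{−k}`): sites of `T_ε`; `dist x y = L^{−k}|x − y|`;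
`G j x y = (L^kε)^{d−2}·|G^η_{(j)}(x,y)|` and `dG j μ x y = (L^kε)^{d−1}·|(D_{A,μ}G^η_{(j)})(x,y)|` — the `η^d`-kernels (block-norm reading) of the
RESCALED slices of (2.43) (p26's `regTorusKernels … absG ∕ absDG` = `ε^{−d}Σ_{i′}‖(G^η_{(j)}e_{(x′,i′)})(x)‖`, times the (2.22) scaling); `B = PEmpty`
((3.64), the vector-field slice along contours, is not a scalar-sector object — empty by type). [cite: King1986, (2.17)–(2.20) p.654, Prop 3.7 (3.63)–(3.65) p.663]
[cite: Balaban1982Higgs1, (2.22) p.610, (2.43) p.612] [cite: Balaban1983Higgs3, (2.6) p.424, (2.10) p.426] -/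
def kingSliceKernelsReg (S : Shape P) (C : ChargeData N) (A : HiggsLattice.VecField P 0) (msq a : ℝ) (k : ℕ) : SliceKernels P.d where
  S := HiggsLattice.Site P 0
  B := PEmpty
  dist x y := (HiggsLattice.Site.tdist x y : ℝ) / (P.L : ℝ) ^ k
  distBlockBond _ _ b := b.elim
  L := P.L
  k := k
  G j x y := P.mesh k ^ ((P.d : ℝ) - 2) * (regTorusKernels S C A msq a k).absG j x y
  dG j μ x y := P.mesh k ^ ((P.d : ℝ) - 1) * (regTorusKernels S C A msq a k).absDG j μ x y
  Gc _ _ b := b.elim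

section Units

variable {S : Shape P} {C : ChargeData N} {A : HiggsLattice.VecField P 0} {msq a : ℝ} {k : ℕ}

/-- King's slice length in his units: `L^jη = L^j·L^{−k} = (L^jε)/(L^kε)`. [cite: King1986, (3.63) p.663] [cite: Balaban1982Higgs1, (1.19) p.607] -/
theorem slice_kingSliceKernelsReg (j : ℕ) : (kingSliceKernelsReg S C A msq a k).slice j = P.mesh j / P.mesh k := by
  show (P.L : ℝ) ^ j * ContinuumLimit.eps P.L k = P.mesh j / P.mesh k
  unfold ContinuumLimit.eps
  rw [mesh_eq_pow_mul P j, mesh_eq_pow_mul P k, mul_div_mul_right _ _ (P.mesh_pos 0).ne', div_eq_mul_inv]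

/-- King's distance in his units: `L^{−k}|x − y| = (ε|x − y|)/(L^kε)`. [cite: King1986, (3.62) p.663] [cite: Balaban1982Higgs1, (1.3) p.604] -/
theorem dist_kingSliceKernelsReg (x y : HiggsLattice.Site P 0) :
    (kingSliceKernelsReg S C A msq a k).dist x y = (P.mesh 0 * (HiggsLattice.Site.tdist x y : ℝ)) / P.mesh k := by
  show (HiggsLattice.Site.tdist x y : ℝ) / (P.L : ℝ) ^ k = _
  rw [mesh_eq_pow_mul P k, mul_comm ((P.L : ℝ) ^ k), mul_div_mul_left _ _ (P.mesh_pos 0).ne']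

/-- the exponent conversion: `δ·(L^jη)^{−1}·(L^{−k}t) = δ·(L^jε)^{−1}·(ε t)`. [cite: King1986, (3.63) p.663] -/
theorem rate_conv (δ t : ℝ) (j : ℕ) :
    δ * ((kingSliceKernelsReg S C A msq a k).slice j)⁻¹ * (P.mesh 0 * t / P.mesh k) = δ * (P.mesh j)⁻¹ * (P.mesh 0 * t) := by
  rw [slice_kingSliceKernelsReg]
  have hk : P.mesh k ≠ 0 := (P.mesh_pos k).ne'
  have hj : P.mesh j ≠ 0 := (P.mesh_pos j).ne'
  field_simp

/-- scaling: `(L^kε)^{d−2+β}·(L^jε)^{2−d−β} = (L^jη)^{2−d−β}` (any real `β`; `β = 0` is (3.63)₁, `β = α` is (3.65)₁). [cite: King1986, (2.20) p.654, (3.63) p.663] -/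
theorem scaling_two (β : ℝ) (j : ℕ) :
    P.mesh k ^ ((P.d : ℝ) - 2 + β) * P.mesh j ^ ((2 : ℝ) - (P.d : ℝ) - β)
      = ((kingSliceKernelsReg S C A msq a k).slice j) ^ ((2 : ℝ) - (P.d : ℝ) - β) := by
  rw [slice_kingSliceKernelsReg, Real.div_rpow (P.mesh_pos j).le (P.mesh_pos k).le, div_eq_mul_inv, ← Real.rpow_neg (P.mesh_pos k).le,
    mul_comm]
  congr 1; congr 1; ring

/-- scaling: `(L^kε)^{d−1+β}·(L^jε)^{1−d−β} = (L^jη)^{1−d−β}` (`β = 0` is (3.63)₂, `β = α` is (3.65)₂). [cite: King1986, (2.20) p.654, (3.63) p.663] -/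
theorem scaling_one (β : ℝ) (j : ℕ) :
    P.mesh k ^ ((P.d : ℝ) - 1 + β) * P.mesh j ^ ((1 : ℝ) - (P.d : ℝ) - β)
      = ((kingSliceKernelsReg S C A msq a k).slice j) ^ ((1 : ℝ) - (P.d : ℝ) - β) := by
  rw [slice_kingSliceKernelsReg, Real.div_rpow (P.mesh_pos j).le (P.mesh_pos k).le, div_eq_mul_inv, ← Real.rpow_neg (P.mesh_pos k).le,
    mul_comm]
  congr 1; congr 1; ring

/-- `(L^kε)^{d−2}·(L^jε)^{2−d} = (L^jη)^{2−d}` ((3.63)₁ scaling). [cite: King1986, (2.20) p.654, (3.63) p.663] -/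
theorem scaling_two' (j : ℕ) :
    P.mesh k ^ ((P.d : ℝ) - 2) * P.mesh j ^ ((2 : ℝ) - (P.d : ℝ))
      = ((kingSliceKernelsReg S C A msq a k).slice j) ^ ((2 : ℝ) - (P.d : ℝ)) := by
  have h := scaling_two (S := S) (C := C) (A := A) (msq := msq) (a := a) (k := k) 0 j
  simp only [add_zero, sub_zero] at h
  exact h

/-- `(L^kε)^{d−1}·(L^jε)^{1−d} = (L^jη)^{1−d}` ((3.63)₂ scaling). [cite: King1986, (2.20) p.654, (3.63) p.663] -/
theorem scaling_one' (j : ℕ) :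
    P.mesh k ^ ((P.d : ℝ) - 1) * P.mesh j ^ ((1 : ℝ) - (P.d : ℝ))
      = ((kingSliceKernelsReg S C A msq a k).slice j) ^ ((1 : ℝ) - (P.d : ℝ)) := by
  have h := scaling_one (S := S) (C := C) (A := A) (msq := msq) (a := a) (k := k) 0 j
  simp only [add_zero, sub_zero] at h
  exact h

/-- the Hölder weight in King's units: `(L^{−k}|x − y|)^{−α}·(ε|x − y|)^α = (L^kε)^α` for `x ≠ y`. [cite: King1986, (3.62) p.663] -/
theorem holderWeight_conv {α : ℝ} {x y : HiggsLattice.Site P 0} (hxy : x ≠ y) :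
    ((kingSliceKernelsReg S C A msq a k).dist x y) ^ (-α) * (P.mesh 0 * (HiggsLattice.Site.tdist x y : ℝ)) ^ α = P.mesh k ^ α := by
  rw [dist_kingSliceKernelsReg]
  have hr : 0 < P.mesh 0 * (HiggsLattice.Site.tdist x y : ℝ) := by
    have : (1 : ℝ) ≤ HiggsLattice.Site.tdist x y := by exact_mod_cast one_le_tdist_of_ne' (Ne.symm hxy)
    have := P.mesh_pos 0
    positivity
  rw [Real.rpow_neg (div_nonneg hr.le (P.mesh_pos k).le), Real.div_rpow hr.le (P.mesh_pos k).le, inv_div,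
    div_mul_cancel₀ _ (Real.rpow_pos_of_pos hr α).ne']

/-- positivity of King's distance forces distinct sites. [cite: Balaban1982Higgs1, (1.3) p.604] -/
theorem ne_of_dist_pos {x y : HiggsLattice.Site P 0} (h : 0 < (kingSliceKernelsReg S C A msq a k).dist x y) : x ≠ y := by
  rintro rfl
  have : (kingSliceKernelsReg S C A msq a k).dist x x = 0 := by
    show (HiggsLattice.Site.tdist x x : ℝ) / (P.L : ℝ) ^ k = 0
    rw [tdist_self]; simp
  rw [this] at h; exact lt_irrefl _ h

/-- `min` commutes with King's rescaling of distances. [folklore] -/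
theorem min_dist_conv (x y z : HiggsLattice.Site P 0) :
    min ((kingSliceKernelsReg S C A msq a k).dist x z) ((kingSliceKernelsReg S C A msq a k).dist y z)
      = P.mesh 0 * min (HiggsLattice.Site.tdist x z : ℝ) (HiggsLattice.Site.tdist y z : ℝ) / P.mesh k := by
  rw [dist_kingSliceKernelsReg, dist_kingSliceKernelsReg, min_div_div_right (P.mesh_pos k).le,
    ← mul_min_of_nonneg _ _ (P.mesh_pos 0).le]

end Units

/-! ## §2 Proposition 3.7 at one Hölder exponent, BY NAME, at a regular background -/

section Main

variable {S : Shape P} {C : ChargeData N} {A : HiggsLattice.VecField P 0} {msq a : ℝ} {k : ℕ}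

/-- ★★ **TRANSFER**: (2.10) at `(δ, Cst)` and (2.11) at `(α, δ, Cst)` for p26's Hölder carrier ⇒ `Prop37PrintedAt α` for King's datum with the
constants `((d·e^{δd} + 2)·Cst, δ)`. [cite: King1986, Prop 3.7 (3.63)–(3.65) p.663] [cite: Balaban1983Higgs3, (2.10)–(2.11) p.426] -/
theorem prop37PrintedAt_of_ineq210_211 {α δ Cst : ℝ} (hα0 : 0 ≤ α) (hα1 : α ≤ 1) (hδ : 0 ≤ δ) (hCst : 0 ≤ Cst)
    (h210 : (regTorusKernelsH S C A msq a k).Ineq210 δ Cst) (h211 : (regTorusKernelsH S C A msq a k).Ineq211At α δ Cst) :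
    Prop37PrintedAt α (kingSliceKernelsReg S C A msq a k) (((P.d : ℝ) * Real.exp (δ * P.d) + 2) * Cst) δ := by
  rw [ineq210_iff_H] at h210
  set C' : ℝ := ((P.d : ℝ) * Real.exp (δ * P.d) + 2) * Cst with hC'
  have hε : 0 < P.mesh 0 := P.mesh_pos 0
  have hmk : 0 < P.mesh k := P.mesh_pos k
  have hCC' : Cst ≤ C' := by
    rw [hC']
    have : (1 : ℝ) ≤ (P.d : ℝ) * Real.exp (δ * P.d) + 2 := by
      have : 0 ≤ (P.d : ℝ) * Real.exp (δ * P.d) := by positivity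
      linarith
    nlinarith
  have hC'0 : 0 ≤ C' := hCst.trans hCC'
  intro j _hj
  have hsj : 0 < P.mesh j := P.mesh_pos j
  refine ⟨fun x y => ⟨?_, fun μ => ?_⟩, fun x b => b.elim, fun x y z hxy => ⟨?_, fun μ => ?_⟩⟩
  · -- (3.63)₁ ⇐ (2.10) value member
    have hb := (h210 j x y).1
    rw [scale_eq, regTorusKernels_dist] at hb
    show |P.mesh k ^ ((P.d : ℝ) - 2) * (regTorusKernels S C A msq a k).absG j x y|
        ≤ C' * (kingSliceKernelsReg S C A msq a k).slice j ^ ((2 : ℝ) - (P.d : ℝ)) * Real.exp (-(δ * ((kingSliceKernelsReg S C A msq a k).slice j)⁻¹ * (kingSliceKernelsReg S C A msq a k).dist x y))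
    rw [abs_of_nonneg (mul_nonneg (Real.rpow_nonneg hmk.le _) (absG_nonneg j x y)), dist_kingSliceKernelsReg, rate_conv,
      ← scaling_two' j]
    calc P.mesh k ^ ((P.d : ℝ) - 2) * (regTorusKernels S C A msq a k).absG j x y
        ≤ P.mesh k ^ ((P.d : ℝ) - 2) * (Cst * P.mesh j ^ ((2 : ℝ) - (P.d : ℝ)) *
            Real.exp (-(δ * (P.mesh j)⁻¹ * (P.mesh 0 * (HiggsLattice.Site.tdist x y : ℝ))))) :=
          mul_le_mul_of_nonneg_left hb (Real.rpow_nonneg hmk.le _)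
      _ = Cst * (P.mesh k ^ ((P.d : ℝ) - 2) * P.mesh j ^ ((2 : ℝ) - (P.d : ℝ))) *
            Real.exp (-(δ * (P.mesh j)⁻¹ * (P.mesh 0 * (HiggsLattice.Site.tdist x y : ℝ)))) := by ring
      _ ≤ C' * (P.mesh k ^ ((P.d : ℝ) - 2) * P.mesh j ^ ((2 : ℝ) - (P.d : ℝ))) *
            Real.exp (-(δ * (P.mesh j)⁻¹ * (P.mesh 0 * (HiggsLattice.Site.tdist x y : ℝ)))) :=
          mul_le_mul_of_nonneg_right (mul_le_mul_of_nonneg_right hCC' (by positivity)) (Real.exp_nonneg _)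
  · -- (3.63)₂ ⇐ (2.10) derivative member
    have hb := (h210 j x y).2 μ
    rw [scale_eq, regTorusKernels_dist] at hb
    show |P.mesh k ^ ((P.d : ℝ) - 1) * (regTorusKernels S C A msq a k).absDG j μ x y|
        ≤ C' * (kingSliceKernelsReg S C A msq a k).slice j ^ ((1 : ℝ) - (P.d : ℝ)) * Real.exp (-(δ * ((kingSliceKernelsReg S C A msq a k).slice j)⁻¹ * (kingSliceKernelsReg S C A msq a k).dist x y))
    rw [abs_of_nonneg (mul_nonneg (Real.rpow_nonneg hmk.le _) (absDG_nonneg j μ x y)), dist_kingSliceKernelsReg, rate_conv,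
      ← scaling_one' j]
    calc P.mesh k ^ ((P.d : ℝ) - 1) * (regTorusKernels S C A msq a k).absDG j μ x y
        ≤ P.mesh k ^ ((P.d : ℝ) - 1) * (Cst * P.mesh j ^ ((1 : ℝ) - (P.d : ℝ)) *
            Real.exp (-(δ * (P.mesh j)⁻¹ * (P.mesh 0 * (HiggsLattice.Site.tdist x y : ℝ))))) :=
          mul_le_mul_of_nonneg_left hb (Real.rpow_nonneg hmk.le _)
      _ = Cst * (P.mesh k ^ ((P.d : ℝ) - 1) * P.mesh j ^ ((1 : ℝ) - (P.d : ℝ))) *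
            Real.exp (-(δ * (P.mesh j)⁻¹ * (P.mesh 0 * (HiggsLattice.Site.tdist x y : ℝ)))) := by ring
      _ ≤ C' * (P.mesh k ^ ((P.d : ℝ) - 1) * P.mesh j ^ ((1 : ℝ) - (P.d : ℝ))) *
            Real.exp (-(δ * (P.mesh j)⁻¹ * (P.mesh 0 * (HiggsLattice.Site.tdist x y : ℝ)))) :=
          mul_le_mul_of_nonneg_right (mul_le_mul_of_nonneg_right hCC' (by positivity)) (Real.exp_nonneg _)
  · -- (3.65)₁ ⇐ PART Ζ-a `absG_holder_le`
    have hne : x ≠ y := ne_of_dist_pos hxy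
    have hb := absG_holder_le (S := S) (C := C) (A := A) (msq := msq) (a := a) (k := k) hδ hCst h210 hα0 hα1 j hne z
    show |((kingSliceKernelsReg S C A msq a k).dist x y) ^ (-α) * (P.mesh k ^ ((P.d : ℝ) - 2) * (regTorusKernels S C A msq a k).absG j x z
            - P.mesh k ^ ((P.d : ℝ) - 2) * (regTorusKernels S C A msq a k).absG j y z)|
        ≤ C' * (kingSliceKernelsReg S C A msq a k).slice j ^ ((2 : ℝ) - (P.d : ℝ) - α) * Real.exp (-(δ * ((kingSliceKernelsReg S C A msq a k).slice j)⁻¹ * min ((kingSliceKernelsReg S C A msq a k).dist x z) ((kingSliceKernelsReg S C A msq a k).dist y z)))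
    rw [← mul_sub, ← mul_assoc, abs_mul, abs_of_nonneg (mul_nonneg (Real.rpow_nonneg (le_of_lt hxy) _) (Real.rpow_nonneg hmk.le _)),
      min_dist_conv, rate_conv, ← scaling_two α j, hC']
    have hw := holderWeight_conv (S := S) (C := C) (A := A) (msq := msq) (a := a) (k := k) (α := α) hne
    set W : ℝ := (kingSliceKernelsReg S C A msq a k).dist x y ^ (-α) with hWdef
    have hW0 : 0 ≤ W := Real.rpow_nonneg (le_of_lt hxy) _
    set E : ℝ := Real.exp (-(δ * (P.mesh j)⁻¹ * (P.mesh 0 * min (HiggsLattice.Site.tdist x z : ℝ) (HiggsLattice.Site.tdist y z : ℝ)))) with hE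
    calc W * P.mesh k ^ ((P.d : ℝ) - 2) * |(regTorusKernels S C A msq a k).absG j x z - (regTorusKernels S C A msq a k).absG j y z|
        ≤ W * P.mesh k ^ ((P.d : ℝ) - 2) * (((P.d : ℝ) * Real.exp (δ * P.d) + 2) * Cst *
            (P.mesh 0 * (HiggsLattice.Site.tdist x y : ℝ)) ^ α * P.mesh j ^ ((2 : ℝ) - (P.d : ℝ) - α) * E) :=
          mul_le_mul_of_nonneg_left hb (mul_nonneg hW0 (Real.rpow_nonneg hmk.le _))
      _ = ((P.d : ℝ) * Real.exp (δ * P.d) + 2) * Cst *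
            ((W * (P.mesh 0 * (HiggsLattice.Site.tdist x y : ℝ)) ^ α) * P.mesh k ^ ((P.d : ℝ) - 2) * P.mesh j ^ ((2 : ℝ) - (P.d : ℝ) - α)) * E := by
          ring
      _ = ((P.d : ℝ) * Real.exp (δ * P.d) + 2) * Cst *
            (P.mesh k ^ ((P.d : ℝ) - 2 + α) * P.mesh j ^ ((2 : ℝ) - (P.d : ℝ) - α)) * E := by
          rw [hWdef, hw, mul_comm (P.mesh k ^ α), ← Real.rpow_add hmk]
  · -- (3.65)₂ ⇐ PART Ζ-a `absDG_holder_le` ((2.11) + isometry)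
    have hne : x ≠ y := ne_of_dist_pos hxy
    have hb := absDG_holder_le (S := S) (C := C) (A := A) (msq := msq) (a := a) (k := k) h211 j μ hne z
    show |((kingSliceKernelsReg S C A msq a k).dist x y) ^ (-α) * (P.mesh k ^ ((P.d : ℝ) - 1) * (regTorusKernels S C A msq a k).absDG j μ x z
            - P.mesh k ^ ((P.d : ℝ) - 1) * (regTorusKernels S C A msq a k).absDG j μ y z)|
        ≤ C' * (kingSliceKernelsReg S C A msq a k).slice j ^ ((1 : ℝ) - (P.d : ℝ) - α) * Real.exp (-(δ * ((kingSliceKernelsReg S C A msq a k).slice j)⁻¹ * min ((kingSliceKernelsReg S C A msq a k).dist x z) ((kingSliceKernelsReg S C A msq a k).dist y z)))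
    rw [← mul_sub, ← mul_assoc, abs_mul, abs_of_nonneg (mul_nonneg (Real.rpow_nonneg (le_of_lt hxy) _) (Real.rpow_nonneg hmk.le _)),
      min_dist_conv, rate_conv, ← scaling_one α j]
    have hw := holderWeight_conv (S := S) (C := C) (A := A) (msq := msq) (a := a) (k := k) (α := α) hne
    set W : ℝ := (kingSliceKernelsReg S C A msq a k).dist x y ^ (-α) with hWdef
    have hW0 : 0 ≤ W := Real.rpow_nonneg (le_of_lt hxy) _
    set E : ℝ := Real.exp (-(δ * (P.mesh j)⁻¹ * (P.mesh 0 * min (HiggsLattice.Site.tdist x z : ℝ) (HiggsLattice.Site.tdist y z : ℝ)))) with hE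
    calc W * P.mesh k ^ ((P.d : ℝ) - 1) * |(regTorusKernels S C A msq a k).absDG j μ x z - (regTorusKernels S C A msq a k).absDG j μ y z|
        ≤ W * P.mesh k ^ ((P.d : ℝ) - 1) * (Cst * (P.mesh 0 * (HiggsLattice.Site.tdist x y : ℝ)) ^ α * P.mesh j ^ ((1 : ℝ) - (P.d : ℝ) - α) * E) :=
          mul_le_mul_of_nonneg_left hb (mul_nonneg hW0 (Real.rpow_nonneg hmk.le _))
      _ = Cst * ((W * (P.mesh 0 * (HiggsLattice.Site.tdist x y : ℝ)) ^ α) * P.mesh k ^ ((P.d : ℝ) - 1) * P.mesh j ^ ((1 : ℝ) - (P.d : ℝ) - α)) * E := by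
          ring
      _ = Cst * (P.mesh k ^ ((P.d : ℝ) - 1 + α) * P.mesh j ^ ((1 : ℝ) - (P.d : ℝ) - α)) * E := by
          rw [hWdef, hw, mul_comm (P.mesh k ^ α), ← Real.rpow_add hmk]
      _ ≤ C' * (P.mesh k ^ ((P.d : ℝ) - 1 + α) * P.mesh j ^ ((1 : ℝ) - (P.d : ℝ) - α)) * E :=
          mul_le_mul_of_nonneg_right (mul_le_mul_of_nonneg_right hCC' (by positivity)) (Real.exp_nonneg _)

/-- ★★★ **KING 1986 PROPOSITION 3.7 BY NAME AT A REGULAR BACKGROUND `A ≠ 0`, `Ω = T_ε`, KING's ORDER** («for x, y, z ∈ T_η, 0 < α < 1, and all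
0 ≤ j ≤ k − 1»; p. 665 «also holds for G_(j)(Ω′, A^{(k)})»): there is a cube-size threshold `K₀min`, and for every `α ∈ (0, 1)` functions
`t, C, δ₀ > 0` of the cube size, such that for all `K₀ ≥ K₀min`, every cubic torus of r14's sub-family (`K₀ ∣ M`, `3K₀ ≤ 2M`), every level
`1 ≤ k ≤ K_P` with `L^kε ≤ 1` and every field `A` on `T_ε` with one-step differences `≤ δ_A`, `L^k·δ_A·|e| ≤ t(K₀)` ([Ba1] (2.23) ∕ King (3.5) in
r14's one-parameter currency): `Prop37PrintedAt α (kingSliceKernelsReg S C A m² a k) (C K₀) (δ₀ K₀)` — from p26's [Ba3] (2.10)∕(2.11)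
(`ineq210_and_211At_regularTorusH`) by PART Ζ-a. [cite: King1986, Prop 3.7 (3.63)–(3.65) p.663, p.665, Def. 3.2 (3.5) p.655]
[cite: Balaban1983Higgs3, (2.10)–(2.11) p.426] [cite: Balaban1982Higgs1, Prop. 2.1 (2.23)–(2.25) p.610, Prop. 2.3 (2.34) p.611, (2.43) p.612] -/
theorem prop37PrintedAt_king_regularField (d L : ℕ) (hL : Odd L ∧ 1 < L) {a : ℝ} (ha : 0 < a) {msq : ℝ} (hmsq : 0 < msq)
    (N : ℕ) (C : ChargeData N) :
    ∃ K₀min : ℕ, ∀ {α : ℝ}, 0 < α → α < 1 →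
      ∃ t Cst δ₀ : ℕ → ℝ, (∀ K₀, 0 < t K₀ ∧ 0 < Cst K₀ ∧ 0 < δ₀ K₀) ∧
      ∀ K₀ : ℕ, K₀min ≤ K₀ →
      ∀ (P : HiggsLattice.Params) (S : Shape P), P.d = d → P.L = L → K₀ ∣ P.M → 3 * K₀ ≤ 2 * P.M →
      ∀ {k : ℕ}, 1 ≤ k → k ≤ P.K → P.mesh k ≤ 1 →
      ∀ (A : HiggsLattice.VecField P 0) {δA : ℝ}, 0 ≤ δA →
        (∀ (z : HiggsLattice.Site P 0) (μ ν : Fin P.d), |A ⟨z.shift ν, μ⟩ - A ⟨z, μ⟩| ≤ δA) →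
        (P.L : ℝ) ^ k * δA * |C.e| ≤ t K₀ →
        Prop37PrintedAt α (kingSliceKernelsReg S C A msq a k) (Cst K₀) (δ₀ K₀) := by
  obtain ⟨K₀min, h⟩ := ineq210_and_211At_regularTorusH d L hL ha hmsq N C
  refine ⟨K₀min, fun {α} hα0 hα1 => ?_⟩
  obtain ⟨t, δ₁, Cst, hpos, h'⟩ := h hα0.le hα1
  refine ⟨t, fun K₀ => ((d : ℝ) * Real.exp (δ₁ K₀ * d) + 2) * Cst K₀, δ₁,
    fun K₀ => ⟨(hpos K₀).1, mul_pos (by have := (hpos K₀).2.1; positivity) (hpos K₀).2.2, (hpos K₀).2.1⟩, ?_⟩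
  intro K₀ hK₀ P S hPd hPL hK₀M h3M k hk1 hkK hmesh A δA hδA hreg ht
  obtain ⟨h210, h211⟩ := h' K₀ hK₀ P S hPd hPL hK₀M h3M hk1 hkK hmesh A hδA hreg ht
  have hmain := prop37PrintedAt_of_ineq210_211 (S := S) (C := C) (A := A) (msq := msq) (a := a) (k := k)
    hα0.le hα1.le (hpos K₀).2.1.le (hpos K₀).2.2.le h210 h211
  subst hPd
  exact hmain

/-! ## §3 The print-order schema `Prop37KingOrder` for lattice-constant (flat) backgrounds, and the member `A = 0` -/

/-- ★★★ **`Prop37KingOrder` AT EVERY LATTICE-CONSTANT BACKGROUND** (`A(x + e_ν)_μ = A(x)_μ`: the flat connections of the torus — arbitrary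
constant holonomies, `A ≠ 0` allowed): `∃ K₀min, ∀ K₀ ≥ K₀min, ∀ cubic torus (K₀ ∣ M, 3K₀ ≤ 2M), ∀ 1 ≤ k ≤ K_P, L^kε ≤ 1, ∀ A flat:
Prop37KingOrder (kingSliceKernelsReg S C A m² a k)` — for such `A` the regularity smallness `L^k·δ_A·|e| ≤ t(α, K₀)` holds with `δ_A = 0` for EVERY
`α`, so §2 serves all exponents at once. [cite: King1986, Prop 3.7 p.663 «0 < α < 1»] [cite: Balaban1983Higgs3, (2.10)–(2.11) p.426] -/
theorem prop37KingOrder_king_flatField (d L : ℕ) (hL : Odd L ∧ 1 < L) {a : ℝ} (ha : 0 < a) {msq : ℝ} (hmsq : 0 < msq)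
    (N : ℕ) (C : ChargeData N) :
    ∃ K₀min : ℕ, ∀ K₀ : ℕ, K₀min ≤ K₀ →
      ∀ (P : HiggsLattice.Params) (S : Shape P), P.d = d → P.L = L → K₀ ∣ P.M → 3 * K₀ ≤ 2 * P.M →
      ∀ {k : ℕ}, 1 ≤ k → k ≤ P.K → P.mesh k ≤ 1 →
      ∀ (A : HiggsLattice.VecField P 0), (∀ (z : HiggsLattice.Site P 0) (μ ν : Fin P.d), A ⟨z.shift ν, μ⟩ = A ⟨z, μ⟩) →
        Prop37KingOrder (kingSliceKernelsReg S C A msq a k) := by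
  obtain ⟨K₀min, h⟩ := prop37PrintedAt_king_regularField d L hL ha hmsq N C
  refine ⟨K₀min, fun K₀ hK₀ P S hPd hPL hK₀M h3M k hk1 hkK hmesh A hflat α hα0 hα1 => ?_⟩
  obtain ⟨t, Cst, δ₀, hpos, h'⟩ := h hα0 hα1
  refine ⟨Cst K₀, δ₀ K₀, (hpos K₀).2.2, ?_⟩
  refine h' K₀ hK₀ P S hPd hPL hK₀M h3M hk1 hkK hmesh A (δA := 0) le_rfl (fun z μ ν => ?_) ?_
  · rw [hflat z μ ν, sub_self, abs_zero]
  · rw [mul_zero, zero_mul]; exact (hpos K₀).1.le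

/-- **The member `A = 0`** (King's own zero-background case, now through the regular-field pipeline): `Prop37KingOrder (kingSliceKernelsReg S C 0 m² a k)`
on every cubic torus of the sub-family, `1 ≤ k ≤ K_P`, `L^kε ≤ 1`. [cite: King1986, Prop 3.7 p.663] [cite: Balaban1983Higgs3, (2.10)–(2.11) p.426] -/
theorem prop37KingOrder_king_zeroField_reg (d L : ℕ) (hL : Odd L ∧ 1 < L) {a : ℝ} (ha : 0 < a) {msq : ℝ} (hmsq : 0 < msq)
    (N : ℕ) (C : ChargeData N) :
    ∃ K₀min : ℕ, ∀ K₀ : ℕ, K₀min ≤ K₀ →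
      ∀ (P : HiggsLattice.Params) (S : Shape P), P.d = d → P.L = L → K₀ ∣ P.M → 3 * K₀ ≤ 2 * P.M →
      ∀ {k : ℕ}, 1 ≤ k → k ≤ P.K → P.mesh k ≤ 1 →
        Prop37KingOrder (kingSliceKernelsReg S C (0 : HiggsLattice.VecField P 0) msq a k) := by
  obtain ⟨K₀min, h⟩ := prop37KingOrder_king_flatField d L hL ha hmsq N C
  exact ⟨K₀min, fun K₀ hK₀ P S hPd hPL hK₀M h3M k hk1 hkK hmesh =>
    h K₀ hK₀ P S hPd hPL hK₀M h3M hk1 hkK hmesh 0 fun _ _ _ => rfl⟩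

end Main

end Summit.QuantumFields.YangMills.BalabanUVNodes.N15KingModelRung.RegularField

end
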